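import Mathlib.Algebra.BigOperators.Fin
import Mathlib.Algebra.BigOperators.Ring.Finset
import Mathlib.Algebra.Order.BigOperators.Group.Finset
import Mathlib.Algebra.Order.BigOperators.Ring.Finset
import Mathlib.Analysis.SpecialFunctions.Pow.Real
import Mathlib.Data.Fintype.BigOperators
import Mathlib.Data.Fintype.Pi
import Mathlib.Data.Real.Basic
import Mathlib.Logic.Equiv.Fin.Basic
import Mathlib.Logic.Equiv.Prod
import Mathlib.Tactic.Linarith
import Mathlib.Tactic.Positivity
import Mathlib.Tactic.Ring
import HarnessLib

/-!
# Product weights on function spaces: pushforward, telescoping, domination, marginalisation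

Trunk T-CPLX-CORE, generic finite probability written as `Finset` sums (no measure theory), in the
style of `PlantedSampleHiding.lean` / `IndependentMarksTail.lean`. App. D campaign (design v3),
part P1, of the discharge of `Literature.Barriers.PneNP.AkaviaEtAl2006_complMemIPk`
(Akavia–Goldreich–Goldwasser–Moshkovitz, STOC 2006, App. D), but independent of it.

A **product weight** on the function space `ι → γ` (finitely many independent coordinates) is
`a ↦ ∏ j, w j (a j)` for coordinate weights `w j : γ → ℝ≥0`; its **mass** is `∏ j, Σ_o w j o`
(`sum_prod_weight`). The protocol analyses of App. D repeatedly (i) push a uniform count over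
independent coins forward to such a weight on the tuple of derived values, (ii) compare two
product weights coordinate-wise, (iii) replace coordinates an event does not look at. This file
proves exactly these manipulations, once:

* `card_filter_forall_eq_prod`, `card_filter_comp_eq_sum` — **pushforward**: the number of coin
  tuples `b : ι → β` whose derived tuple `(φ j (b j))_j` lies in an event `E` is
  `Σ_{a ∈ E} ∏ j #{x | φ j x = a j}`;
* `sum_abs_prod_sub_prod_le` (index `Fin N`) — **telescoping / hybrid bound**: for coordinate
  weights of common mass `M`, `Σ_a |∏ w - ∏ w'| ≤ M^{N-1} Σ_j ‖w j - w' j‖₁` (so an event's weight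
  moves by at most the sum of the coordinate `ℓ¹`-distances, in units of the mass);
* `one_sub_sum_le_prod_one_sub` (Weierstrass), `prod_weight_ge_of_pointwise`,
  `sum_prod_weight_ge_of_pointwise`, `sum_prod_weight_le_of_pointwise` — **domination**: if
  `w j ≥ (1 - ε j) v j` pointwise then every event has `w`-weight `≥ (1 - Σ ε) ·` its `v`-weight,
  and (for equal masses) `≤` its `v`-weight `+ (Σ ε) M^{|ι|}`;
* `sum_prod_weight_congr_off` — **marginalisation**: coordinates on which the event does not
  depend may carry any weights of the same mass;
* `sum_prod_weight_le_robust` — **robust hybrid bound**: if `E'` contains every tuple within `v`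
  changed coordinates of `E`, then `P_w(E) ≤ P_{w'}(E') + (Σ_j TV(w j, w' j))/v` — discrepancies
  are paid through the number of differing coordinates (Markov), the form needed when an event
  (a majority over many runs) tolerates a few corrupted coordinates.

Mathlib only, all proved, [folklore] throughout (finite product measures).

## References

* [folklore] finite product probability spaces; the hybrid argument.
* S. Arora, B. Barak, *Computational Complexity: A Modern Approach*, CUP 2009, §A.2 (finite
  probability as counting).
-/

noncomputable section

namespace Literature.Computability.Complexity

namespace ProductWeights

open Finset

variable {ι β γ : Type*}

/-! ### Mass and pushforward -/

/-- **Mass of a product weight**: `Σ_a ∏ j w j (a j) = ∏ j Σ_o w j o`. [folklore] -/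
theorem sum_prod_weight [Fintype ι] [DecidableEq ι] [Fintype γ] (w : ι → γ → ℝ) :
    ∑ a : ι → γ, ∏ j, w j (a j) = ∏ j, ∑ o, w j o := by
  rw [Finset.prod_univ_sum (fun _ => (univ : Finset γ)) w, Fintype.piFinset_univ]

/-- **Counting a coordinate-wise fibre**: the coin tuples `b` with `φ j (b j) = a j` for all `j`
number `∏ j #{x | φ j x = a j}`. [folklore] -/
theorem card_filter_forall_eq_prod [Fintype ι] [DecidableEq ι] [Fintype β] [DecidableEq γ]
    (φ : ι → β → γ) (a : ι → γ) :
    (univ.filter fun b : ι → β => ∀ j, φ j (b j) = a j).card =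
      ∏ j, (univ.filter fun x : β => φ j x = a j).card := by
  rw [← Fintype.card_piFinset]
  congr 1
  ext b
  simp [Fintype.mem_piFinset]

/-- **Pushforward of the uniform count to the product weight**: the coin tuples whose derived tuple
lies in `E` number `Σ_a [E a] · ∏ j #{x | φ j x = a j}`. [folklore] -/
theorem card_filter_comp_eq_sum [Fintype ι] [DecidableEq ι] [Fintype β] [Fintype γ] [DecidableEq γ]
    (φ : ι → β → γ) (E : (ι → γ) → Prop) [DecidablePred E] :
    ((univ.filter fun b : ι → β => E (fun j => φ j (b j))).card : ℝ) =
      ∑ a : ι → γ, (if E a then (∏ j, ((univ.filter fun x : β => φ j x = a j).card : ℝ)) else 0) := by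
  rw [card_eq_sum_card_fiberwise (f := fun (b : ι → β) (j : ι) => φ j (b j)) (t := univ)
    fun _ _ => mem_univ _]
  push_cast
  refine sum_congr rfl fun a _ => ?_
  by_cases hE : E a
  · rw [if_pos hE, ← Nat.cast_prod, ← card_filter_forall_eq_prod]
    congr 2
    ext b
    simp only [mem_filter, mem_univ, true_and]
    constructor
    · rintro ⟨-, h⟩ j; exact congr_fun h j
    · intro h
      have : (fun j => φ j (b j)) = a := funext h
      exact ⟨this ▸ hE, this⟩
  · rw [if_neg hE]
    norm_cast
    rw [card_eq_zero, filter_eq_empty_iff]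
    rintro b hb rfl
    exact hE (mem_filter.1 hb).2

/-! ### Telescoping (hybrid) bound -/

/-- **The hybrid bound**: for coordinate weights `w, w'` on `Fin N` coordinates, nonnegative and all
of mass `M`, `Σ_a |∏ j w j (a j) - ∏ j w' j (a j)| ≤ M^{N-1} · Σ_j Σ_o |w j o - w' j o|`.
[folklore] -/
theorem sum_abs_prod_sub_prod_le [Fintype γ] {N : ℕ} (w w' : Fin N → γ → ℝ) (hw : ∀ j o, 0 ≤ w j o)
    (hw' : ∀ j o, 0 ≤ w' j o) {M : ℝ} (hM : ∀ j, ∑ o, w j o = M) (hM' : ∀ j, ∑ o, w' j o = M) :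
    ∑ a : Fin N → γ, |∏ j, w j (a j) - ∏ j, w' j (a j)| ≤
      M ^ (N - 1) * ∑ j, ∑ o, |w j o - w' j o| := by
  induction N with
  | zero => simp
  | succ N ih =>
    -- split off coordinate `0`
    have hsplit : ∑ a : Fin (N + 1) → γ, |∏ j, w j (a j) - ∏ j, w' j (a j)| =
        ∑ x : γ, ∑ b : Fin N → γ,
          |w 0 x * ∏ j : Fin N, w j.succ (b j) - w' 0 x * ∏ j : Fin N, w' j.succ (b j)| := by
      rw [← Fintype.sum_prod_type']
      refine Fintype.sum_equiv (Fin.consEquiv fun _ => γ).symm _ _ fun a => ?_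
      rw [Fin.prod_univ_succ, Fin.prod_univ_succ]
      rfl
    rw [hsplit]
    set P : (Fin N → γ) → ℝ := fun b => ∏ j : Fin N, w j.succ (b j) with hP
    set P' : (Fin N → γ) → ℝ := fun b => ∏ j : Fin N, w' j.succ (b j) with hP'
    have hPnn : ∀ b, 0 ≤ P b := fun b => prod_nonneg fun j _ => hw _ _
    have hP'nn : ∀ b, 0 ≤ P' b := fun b => prod_nonneg fun j _ => hw' _ _
    have hPsum : ∑ b, P b = M ^ N := by
      have h := sum_prod_weight (ι := Fin N) (fun j => w j.succ)
      simp only [hM, prod_const, card_univ, Fintype.card_fin] at h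
      rw [← h]
    have hIH := ih (fun j => w j.succ) (fun j => w' j.succ) (fun j o => hw _ _) (fun j o => hw' _ _)
      (fun j => hM _) (fun j => hM' _)
    -- pointwise: `|u P - u' P'| ≤ |u - u'| P + u' |P - P'|`
    have hpt : ∀ (x : γ) (b : Fin N → γ),
        |w 0 x * P b - w' 0 x * P' b| ≤ |w 0 x - w' 0 x| * P b + w' 0 x * |P b - P' b| := by
      intro x b
      have : w 0 x * P b - w' 0 x * P' b = (w 0 x - w' 0 x) * P b + w' 0 x * (P b - P' b) := by
        ring
      rw [this]
      refine (abs_add_le _ _).trans (le_of_eq ?_)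
      rw [abs_mul, abs_mul, abs_of_nonneg (hPnn b), abs_of_nonneg (hw' 0 x)]
    calc ∑ x : γ, ∑ b : Fin N → γ, |w 0 x * P b - w' 0 x * P' b|
        ≤ ∑ x : γ, ∑ b : Fin N → γ, (|w 0 x - w' 0 x| * P b + w' 0 x * |P b - P' b|) :=
          sum_le_sum fun x _ => sum_le_sum fun b _ => hpt x b
      _ = (∑ x, |w 0 x - w' 0 x|) * M ^ N + M * ∑ b, |P b - P' b| := by
          simp only [sum_add_distrib, ← mul_sum, ← sum_mul, hPsum, hM' 0]
      _ ≤ (∑ x, |w 0 x - w' 0 x|) * M ^ N +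
            M * (M ^ (N - 1) * ∑ j : Fin N, ∑ o, |w j.succ o - w' j.succ o|) := by
          have hMnn : 0 ≤ M := by rw [← hM 0]; exact sum_nonneg fun o _ => hw 0 o
          have := mul_le_mul_of_nonneg_left hIH hMnn
          linarith
      _ ≤ M ^ N * ∑ j : Fin (N + 1), ∑ o, |w j o - w' j o| := by
          rw [Fin.sum_univ_succ, mul_add]
          have hrest : M * (M ^ (N - 1) * ∑ j : Fin N, ∑ o, |w j.succ o - w' j.succ o|) ≤
              M ^ N * ∑ j : Fin N, ∑ o, |w j.succ o - w' j.succ o| := by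
            rcases Nat.eq_zero_or_pos N with hN | hN
            · subst hN; simp
            · rw [← mul_assoc, ← pow_succ', Nat.sub_add_cancel hN]
          have hcomm : (∑ x, |w 0 x - w' 0 x|) * M ^ N = M ^ N * ∑ x, |w 0 x - w' 0 x| :=
            mul_comm _ _
          linarith

/-! ### Domination -/

/-- **Weierstrass' product inequality**: `1 - Σ ε ≤ ∏ (1 - ε j)` for `ε j ∈ [0, 1]`. [folklore] -/
theorem one_sub_sum_le_prod_one_sub (s : Finset ι) (ε : ι → ℝ) (h0 : ∀ j ∈ s, 0 ≤ ε j)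
    (h1 : ∀ j ∈ s, ε j ≤ 1) : 1 - ∑ j ∈ s, ε j ≤ ∏ j ∈ s, (1 - ε j) := by
  classical
  induction s using Finset.induction_on with
  | empty => simp
  | insert a s has ih =>
    rw [sum_insert has, prod_insert has]
    have ih' := ih (fun j hj => h0 j (mem_insert_of_mem hj)) (fun j hj => h1 j (mem_insert_of_mem hj))
    have ha0 := h0 a (mem_insert_self a s)
    have ha1 := h1 a (mem_insert_self a s)
    have hs0 : 0 ≤ ∑ j ∈ s, ε j := sum_nonneg fun j hj => h0 j (mem_insert_of_mem hj)
    have hprod : (1 - ε a) * (1 - ∑ j ∈ s, ε j) ≤ (1 - ε a) * ∏ j ∈ s, (1 - ε j) :=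
      mul_le_mul_of_nonneg_left ih' (by linarith)
    nlinarith

/-- **Pointwise domination multiplies**: if `w j ≥ (1 - ε j) · v j` pointwise (`ε j ≥ 0`,
`v, w ≥ 0`), then `∏ w j (a j) ≥ (1 - Σ ε) ∏ v j (a j)`. [folklore] -/
theorem prod_weight_ge_of_pointwise [Fintype ι] (ε : ι → ℝ) (v w : ι → γ → ℝ) (hε : ∀ j, 0 ≤ ε j)
    (hv : ∀ j o, 0 ≤ v j o) (hw : ∀ j o, 0 ≤ w j o)
    (hdom : ∀ j o, (1 - ε j) * v j o ≤ w j o) (a : ι → γ) :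
    (1 - ∑ j, ε j) * ∏ j, v j (a j) ≤ ∏ j, w j (a j) := by
  by_cases h1 : ∀ j, ε j ≤ 1
  · calc (1 - ∑ j, ε j) * ∏ j, v j (a j)
        ≤ (∏ j, (1 - ε j)) * ∏ j, v j (a j) :=
          mul_le_mul_of_nonneg_right
            (one_sub_sum_le_prod_one_sub univ ε (fun j _ => hε j) fun j _ => h1 j)
            (prod_nonneg fun j _ => hv j _)
      _ = ∏ j, (1 - ε j) * v j (a j) := by rw [← prod_mul_distrib]
      _ ≤ ∏ j, w j (a j) :=
          prod_le_prod (fun j _ => mul_nonneg (by linarith [h1 j]) (hv j _)) fun j _ => hdom j _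
  · push Not at h1
    obtain ⟨j, hj⟩ := h1
    have : ε j ≤ ∑ i, ε i := single_le_sum (f := ε) (fun i _ => hε i) (mem_univ j)
    have hneg : 1 - ∑ i, ε i ≤ 0 := by linarith
    exact (mul_nonpos_of_nonpos_of_nonneg hneg (prod_nonneg fun j _ => hv j _)).trans
      (prod_nonneg fun j _ => hw j _)

/-- **Domination of events, lower form**: under the hypotheses of `prod_weight_ge_of_pointwise`,
every event has `w`-weight at least `(1 - Σ ε)` times its `v`-weight. [folklore] -/
theorem sum_prod_weight_ge_of_pointwise [Fintype ι] [DecidableEq ι] [Fintype γ] (ε : ι → ℝ)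
    (v w : ι → γ → ℝ) (hε : ∀ j, 0 ≤ ε j)
    (hv : ∀ j o, 0 ≤ v j o) (hw : ∀ j o, 0 ≤ w j o)
    (hdom : ∀ j o, (1 - ε j) * v j o ≤ w j o) (E : (ι → γ) → Prop) [DecidablePred E] :
    (1 - ∑ j, ε j) * ∑ a : ι → γ, (if E a then ∏ j, v j (a j) else 0) ≤
      ∑ a : ι → γ, (if E a then ∏ j, w j (a j) else 0) := by
  rw [mul_sum]
  refine sum_le_sum fun a _ => ?_
  split_ifs with hE
  · exact prod_weight_ge_of_pointwise ε v w hε hv hw hdom a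
  · simp

/-- **Domination of events, upper form**: if moreover all coordinate masses equal `M`, every event
has `w`-weight at most its `v`-weight plus `(Σ ε) · M^{|ι|}` (apply the lower form to the
complement). [folklore] -/
theorem sum_prod_weight_le_of_pointwise [Fintype ι] [DecidableEq ι] [Fintype γ] (ε : ι → ℝ)
    (v w : ι → γ → ℝ) (hε : ∀ j, 0 ≤ ε j)
    (hv : ∀ j o, 0 ≤ v j o) (hw : ∀ j o, 0 ≤ w j o)
    (hdom : ∀ j o, (1 - ε j) * v j o ≤ w j o) {M : ℝ} (hMv : ∀ j, ∑ o, v j o = M)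
    (hMw : ∀ j, ∑ o, w j o = M) (E : (ι → γ) → Prop) [DecidablePred E] :
    ∑ a : ι → γ, (if E a then ∏ j, w j (a j) else 0) ≤
      ∑ a : ι → γ, (if E a then ∏ j, v j (a j) else 0) + (∑ j, ε j) * M ^ Fintype.card ι := by
  have hcw : ∑ a : ι → γ, (if E a then ∏ j, w j (a j) else 0) +
      ∑ a : ι → γ, (if ¬ E a then ∏ j, w j (a j) else 0) = M ^ Fintype.card ι := by
    rw [← sum_add_distrib]
    have : ∀ a : ι → γ, ((if E a then ∏ j, w j (a j) else 0) +
        if ¬ E a then ∏ j, w j (a j) else 0) = ∏ j, w j (a j) := fun a => by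
      split_ifs <;> simp
    rw [sum_congr rfl fun a _ => this a, sum_prod_weight]
    simp [hMw, prod_const, card_univ]
  have hcv : ∑ a : ι → γ, (if E a then ∏ j, v j (a j) else 0) +
      ∑ a : ι → γ, (if ¬ E a then ∏ j, v j (a j) else 0) = M ^ Fintype.card ι := by
    rw [← sum_add_distrib]
    have : ∀ a : ι → γ, ((if E a then ∏ j, v j (a j) else 0) +
        if ¬ E a then ∏ j, v j (a j) else 0) = ∏ j, v j (a j) := fun a => by
      split_ifs <;> simp
    rw [sum_congr rfl fun a _ => this a, sum_prod_weight]
    simp [hMv, prod_const, card_univ]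
  have hlow := sum_prod_weight_ge_of_pointwise ε v w hε hv hw hdom (fun a => ¬ E a)
  have hεnn : 0 ≤ ∑ j, ε j := sum_nonneg fun j _ => hε j
  have hEvnn : 0 ≤ ∑ a : ι → γ, (if E a then ∏ j, v j (a j) else 0) :=
    sum_nonneg fun a _ => by
      split_ifs
      · exact prod_nonneg fun j _ => hv j _
      · exact le_rfl
  -- `Σ_E w = Mⁿ - Σ_{¬E} w ≤ Mⁿ - (1 - Σε) Σ_{¬E} v = Σ_E v + Σε · Σ_{¬E} v ≤ Σ_E v + Σε · Mⁿ`
  set B' := ∑ a : ι → γ, (if ¬ E a then ∏ j, v j (a j) else 0) with hB'def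
  have hB' : B' ≤ M ^ Fintype.card ι := by linarith
  have hmul := mul_le_mul_of_nonneg_left hB' hεnn
  have hexp : (1 - ∑ j, ε j) * B' = B' - (∑ j, ε j) * B' := by ring
  rw [hexp] at hlow
  linarith

/-! ### Marginalisation: coordinates the event ignores -/

/-- **Coordinates an event does not look at may carry any weights of the same mass.** If `E a`
depends only on the coordinates `a j` with `p j`, `v = v'` on those coordinates, and off them
`v j` and `v' j` have the same mass, then `E` has the same `v`- and `v'`-weight. [folklore] -/
theorem sum_prod_weight_congr_off [Fintype ι] [DecidableEq ι] [Fintype γ] [Nonempty γ] (p : ι → Prop)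
    [DecidablePred p] (E : (ι → γ) → Prop) [DecidablePred E]
    (hE : ∀ a b : ι → γ, (∀ j, p j → a j = b j) → (E a ↔ E b)) (v v' : ι → γ → ℝ)
    (hv : ∀ j, p j → v j = v' j) (hM : ∀ j, ¬ p j → ∑ o, v j o = ∑ o, v' j o) :
    ∑ a : ι → γ, (if E a then ∏ j, v j (a j) else 0) =
      ∑ a : ι → γ, (if E a then ∏ j, v' j (a j) else 0) := by
  -- split the coordinates by `p`
  set e := Equiv.piEquivPiSubtypeProd p (fun _ : ι => γ) with he
  -- the event seen on the `p`-coordinates only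
  have hEsplit : ∀ (a₁ : {j // p j} → γ) (a₂ a₂' : {j // ¬ p j} → γ),
      E (e.symm (a₁, a₂)) ↔ E (e.symm (a₁, a₂')) := by
    intro a₁ a₂ a₂'
    refine hE _ _ fun j hj => ?_
    simp [he, Equiv.piEquivPiSubtypeProd, hj]
  -- general computation for any weight `u`
  have key : ∀ u : ι → γ → ℝ,
      ∑ a : ι → γ, (if E a then ∏ j, u j (a j) else 0) =
        (∑ a₁ : {j // p j} → γ, (if E (e.symm (a₁, fun _ => Classical.arbitrary γ)) then
          ∏ j : {j // p j}, u j (a₁ j) else 0)) * ∏ j : {j // ¬ p j}, ∑ o, u j o := by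
    intro u
    rw [← Equiv.sum_comp e.symm, Fintype.sum_prod_type]
    simp_rw [fun a₁ a₂ => hEsplit a₁ a₂ (fun _ => Classical.arbitrary γ)]
    rw [sum_mul]
    refine sum_congr rfl fun a₁ _ => ?_
    split_ifs with hE1
    · have hfac : ∀ a₂ : {j // ¬ p j} → γ, ∏ j, u j (e.symm (a₁, a₂) j) =
          (∏ j : {j // p j}, u j (a₁ j)) * ∏ j : {j // ¬ p j}, u j (a₂ j) := by
        intro a₂
        rw [← Fintype.prod_subtype_mul_prod_subtype p fun j => u j (e.symm (a₁, a₂) j)]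
        congr 1
        · refine Fintype.prod_congr _ _ fun j => ?_
          simp [he, Equiv.piEquivPiSubtypeProd, j.2]
        · refine Fintype.prod_congr _ _ fun j => ?_
          simp [he, Equiv.piEquivPiSubtypeProd, j.2]
      simp_rw [hfac]
      rw [← mul_sum]
      congr 1
      exact sum_prod_weight (ι := {j // ¬ p j}) (fun j => u j)
    · simp
  rw [key v, key v']
  congr 1
  · refine sum_congr rfl fun a₁ _ => ?_
    split_ifs
    · exact Fintype.prod_congr _ _ fun j => by rw [hv j j.2]
    · rfl
  · exact Fintype.prod_congr _ _ fun j => hM j j.2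

/-! ### The robust hybrid bound: events that tolerate a few changed coordinates -/

/-- **Robust hybrid bound.** Let `w, w'` be nonnegative coordinate weights of common mass `M`, and
let the event `E'` contain every tuple obtained from a tuple of `E` by changing at most `v`
coordinates. Then the `w`-weight of `E` exceeds the `w'`-weight of `E'` by at most
`M^{|ι|-1}/(2v) · Σ_j ‖w j - w' j‖₁` — in probability units, `P(E) ≤ P'(E') + (Σ_j TV_j)/v`:
coordinate-wise discrepancies are paid for only through the NUMBER of coordinates on which
optimally coupled samples differ (Markov), not through their union bound. (Proof without
couplings: split `w j = min(w j, w' j) + excess`, expand the product over the set `T` of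
coordinates drawing from the excess, marginalise `T` when `|T| ≤ v`, and bound the total weight of
`|T| > v` by `E|T|/v`.) [folklore] -/
theorem sum_prod_weight_le_robust [Fintype ι] [DecidableEq ι] [Fintype γ] [DecidableEq γ]
    [Nonempty γ] (w w' : ι → γ → ℝ) (hw : ∀ j o, 0 ≤ w j o) (hw' : ∀ j o, 0 ≤ w' j o) {M : ℝ}
    (hM : ∀ j, ∑ o, w j o = M) (hM' : ∀ j, ∑ o, w' j o = M) (E E' : (ι → γ) → Prop)
    [DecidablePred E] [DecidablePred E'] {v : ℝ} (hv : 0 < v)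
    (hEE' : ∀ a a' : ι → γ, E a → ((univ.filter fun j => a j ≠ a' j).card : ℝ) ≤ v → E' a') :
    ∑ a : ι → γ, (if E a then ∏ j, w j (a j) else 0) ≤
      ∑ a : ι → γ, (if E' a then ∏ j, w' j (a j) else 0) +
        M ^ (Fintype.card ι - 1) / (2 * v) * ∑ j, ∑ o, |w j o - w' j o| := by
  classical
  -- the agreeing part and the two excesses
  set g : ι → γ → ℝ := fun j o => min (w j o) (w' j o) with hg
  set bw : ι → γ → ℝ := fun j o => w j o - g j o with hbw
  set bw' : ι → γ → ℝ := fun j o => w' j o - g j o with hbw'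
  set β : ι → ℝ := fun j => ∑ o, bw j o with hβ
  have hg_nn : ∀ j o, 0 ≤ g j o := fun j o => le_min (hw j o) (hw' j o)
  have hbw_nn : ∀ j o, 0 ≤ bw j o := fun j o => sub_nonneg.2 (min_le_left _ _)
  have hbw'_nn : ∀ j o, 0 ≤ bw' j o := fun j o => sub_nonneg.2 (min_le_right _ _)
  have hw_split : ∀ j o, w j o = bw j o + g j o := fun j o => by simp [hbw]
  have hw'_split : ∀ j o, w' j o = bw' j o + g j o := fun j o => by simp [hbw']
  have habs : ∀ j o, |w j o - w' j o| = bw j o + bw' j o := by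
    intro j o
    simp only [hbw, hbw', hg]
    rcases le_total (w j o) (w' j o) with h | h
    · rw [min_eq_left h, abs_of_nonpos (by linarith)]; ring
    · rw [min_eq_right h, abs_of_nonneg (by linarith)]; ring
  have hβ_nn : ∀ j, 0 ≤ β j := fun j => sum_nonneg fun o _ => hbw_nn j o
  have hmass_g : ∀ j, ∑ o, g j o = M - β j := by
    intro j
    have : ∑ o, w j o = ∑ o, bw j o + ∑ o, g j o := by
      rw [← sum_add_distrib]; exact sum_congr rfl fun o _ => hw_split j o
    rw [hM j] at this
    simp only [hβ]; linarith
  have hmass_bw' : ∀ j, ∑ o, bw' j o = β j := by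
    intro j
    have : ∑ o, w' j o = ∑ o, bw' j o + ∑ o, g j o := by
      rw [← sum_add_distrib]; exact sum_congr rfl fun o _ => hw'_split j o
    rw [hM' j, hmass_g j] at this
    linarith
  have hβ_abs : ∀ j, ∑ o, |w j o - w' j o| = 2 * β j := by
    intro j
    rw [sum_congr rfl fun o _ => habs j o, sum_add_distrib, hmass_bw']
    simp only [hβ]; ring
  -- the hybrid weights indexed by the set `T` of coordinates drawing from the excess
  set V : Finset ι → ι → γ → ℝ := fun T j o => if j ∈ T then bw j o else g j o with hV
  set V' : Finset ι → ι → γ → ℝ := fun T j o => if j ∈ T then bw' j o else g j o with hV'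
  have hV_nn : ∀ T j o, 0 ≤ V T j o := fun T j o => by
    simp only [hV]; split_ifs <;> [exact hbw_nn j o; exact hg_nn j o]
  have hV'_nn : ∀ T j o, 0 ≤ V' T j o := fun T j o => by
    simp only [hV']; split_ifs <;> [exact hbw'_nn j o; exact hg_nn j o]
  -- expanding the products over `T`
  have hexpand : ∀ a : ι → γ, ∏ j, w j (a j) = ∑ T ∈ (univ : Finset ι).powerset, ∏ j, V T j (a j) := by
    intro a
    rw [show (∏ j, w j (a j)) = ∏ j ∈ univ, (bw j (a j) + g j (a j)) from
      prod_congr rfl fun j _ => hw_split j (a j), prod_add]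
    refine sum_congr rfl fun T _ => ?_
    rw [prod_ite]
    simp [sdiff_eq_filter]
  have hexpand' : ∀ a : ι → γ, ∏ j, w' j (a j) = ∑ T ∈ (univ : Finset ι).powerset, ∏ j, V' T j (a j) := by
    intro a
    rw [show (∏ j, w' j (a j)) = ∏ j ∈ univ, (bw' j (a j) + g j (a j)) from
      prod_congr rfl fun j _ => hw'_split j (a j), prod_add]
    refine sum_congr rfl fun T _ => ?_
    rw [prod_ite]
    simp [sdiff_eq_filter]
  -- the mass of a hybrid weight
  have hmassV : ∀ T : Finset ι, ∑ a : ι → γ, ∏ j, V T j (a j) =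
      (∏ j ∈ T, β j) * ∏ j ∈ univ \ T, (M - β j) := by
    intro T
    rw [sum_prod_weight]
    have : ∀ j, ∑ o, V T j o = if j ∈ T then β j else M - β j := by
      intro j; simp only [hV]; split_ifs <;> [rfl; exact hmass_g j]
    rw [prod_congr rfl fun j _ => this j, prod_ite]
    simp [sdiff_eq_filter]
  -- per `T`: few excess coordinates are marginalised, many are rare
  have hT : ∀ T : Finset ι, ∑ a : ι → γ, (if E a then ∏ j, V T j (a j) else 0) ≤
      ∑ a : ι → γ, (if E' a then ∏ j, V' T j (a j) else 0) +
        (if v < T.card then (∏ j ∈ T, β j) * ∏ j ∈ univ \ T, (M - β j) else 0) := by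
    intro T
    by_cases hTv : v < T.card
    · -- many: drop the event
      rw [if_pos hTv]
      have h1 : ∑ a : ι → γ, (if E a then ∏ j, V T j (a j) else 0) ≤
          ∑ a : ι → γ, ∏ j, V T j (a j) :=
        sum_le_sum fun a _ => by
          split_ifs <;> [exact le_rfl; exact prod_nonneg fun j _ => hV_nn T j _]
      have h2 : 0 ≤ ∑ a : ι → γ, (if E' a then ∏ j, V' T j (a j) else 0) :=
        sum_nonneg fun a _ => by
          split_ifs <;> [exact prod_nonneg fun j _ => hV'_nn T j _; exact le_rfl]
      rw [hmassV] at h1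
      linarith
    · -- few: the event survives any change on `T`
      rw [if_neg hTv, add_zero]
      push Not at hTv
      set ET : (ι → γ) → Prop := fun a => ∀ a' : ι → γ, (∀ j, j ∉ T → a' j = a j) → E' a'
        with hET
      have hE_ET : ∀ a, E a → ET a := by
        intro a ha a' ha'
        have hsub : (univ.filter fun j => a j ≠ a' j) ⊆ T := by
          intro j hj
          rw [mem_filter] at hj
          by_contra hjT
          exact hj.2 (ha' j hjT).symm
        exact hEE' a a' ha (le_trans (by exact_mod_cast card_le_card hsub) hTv)
      have hET_E' : ∀ a, ET a → E' a := fun a h => h a fun j _ => rfl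
      have hET_dep : ∀ a b : ι → γ, (∀ j, j ∉ T → a j = b j) → (ET a ↔ ET b) := by
        intro a b hab
        simp only [hET]
        constructor
        · intro h a' ha'; exact h a' fun j hj => (ha' j hj).trans (hab j hj).symm
        · intro h a' ha'; exact h a' fun j hj => (ha' j hj).trans (hab j hj)
      calc ∑ a : ι → γ, (if E a then ∏ j, V T j (a j) else 0)
          ≤ ∑ a : ι → γ, (if ET a then ∏ j, V T j (a j) else 0) :=
            sum_le_sum fun a _ => by
              by_cases hEa : E a
              · rw [if_pos hEa, if_pos (hE_ET a hEa)]
              · rw [if_neg hEa]; split_ifs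
                · exact prod_nonneg fun j _ => hV_nn T j _
                · exact le_rfl
        _ = ∑ a : ι → γ, (if ET a then ∏ j, V' T j (a j) else 0) := by
            refine sum_prod_weight_congr_off (fun j => j ∉ T) ET hET_dep (V T) (V' T)
              (fun j hj => ?_) (fun j hj => ?_)
            · funext o; simp [hV, hV', hj]
            · push Not at hj
              simp only [hV, hV', hj, if_true]
              rw [hmass_bw' j]
        _ ≤ ∑ a : ι → γ, (if E' a then ∏ j, V' T j (a j) else 0) :=
            sum_le_sum fun a _ => by
              by_cases hEa : ET a
              · rw [if_pos hEa, if_pos (hET_E' a hEa)]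
              · rw [if_neg hEa]; split_ifs
                · exact prod_nonneg fun j _ => hV'_nn T j _
                · exact le_rfl
  -- the total weight of `|T| > v`: Markov on `|T|`
  have hrare : ∑ T ∈ (univ : Finset ι).powerset,
      (if v < T.card then (∏ j ∈ T, β j) * ∏ j ∈ univ \ T, (M - β j) else 0) ≤
      (1 / v) * ∑ j, β j * M ^ (Fintype.card ι - 1) := by
    -- `[v < |T|] ≤ |T|/v`
    have hMβ : ∀ j, 0 ≤ M - β j := fun j => by
      rw [← hmass_g j]; exact sum_nonneg fun o _ => hg_nn j o
    have hX : ∀ T : Finset ι, 0 ≤ (∏ j ∈ T, β j) * ∏ j ∈ univ \ T, (M - β j) := fun T =>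
      mul_nonneg (prod_nonneg fun j _ => hβ_nn j) (prod_nonneg fun j _ => hMβ j)
    have h1 : ∑ T ∈ (univ : Finset ι).powerset,
        (if v < T.card then (∏ j ∈ T, β j) * ∏ j ∈ univ \ T, (M - β j) else 0) ≤
        ∑ T ∈ (univ : Finset ι).powerset,
          (T.card : ℝ) / v * ((∏ j ∈ T, β j) * ∏ j ∈ univ \ T, (M - β j)) := by
      refine sum_le_sum fun T _ => ?_
      split_ifs with h
      · have : (1 : ℝ) ≤ T.card / v := by rw [le_div_iff₀ hv]; linarith
        nlinarith [hX T]
      · exact mul_nonneg (div_nonneg (Nat.cast_nonneg _) hv.le) (hX T)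
    refine h1.trans (le_of_eq ?_)
    -- `Σ_T |T| X_T = Σ_j β_j M^{n-1}` by linearity over `j ∈ T`
    have hlin : ∀ j : ι, ∑ T ∈ (univ : Finset ι).powerset,
        (if j ∈ T then (∏ i ∈ T, β i) * ∏ i ∈ univ \ T, (M - β i) else 0) =
        β j * M ^ (Fintype.card ι - 1) := by
      intro j
      -- `prod_add` for the weights `β` and `i ↦ [i ≠ j](M - β i)`
      have hpa := prod_add (fun i => β i) (fun i => if i = j then 0 else M - β i) (univ : Finset ι)
      have hlhs : ∏ i ∈ (univ : Finset ι), (β i + if i = j then 0 else M - β i) =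
          β j * M ^ (Fintype.card ι - 1) := by
        rw [← mul_prod_erase univ _ (mem_univ j)]
        simp only [if_true, add_zero]
        congr 1
        rw [Fintype.card, ← card_erase_of_mem (mem_univ j), ← prod_const]
        exact prod_congr rfl fun i hi => by rw [if_neg (ne_of_mem_erase hi)]; ring
      rw [hlhs] at hpa
      rw [hpa]
      refine sum_congr rfl fun T hT => ?_
      by_cases hjT : j ∈ T
      · rw [if_pos hjT]
        congr 1
        exact prod_congr rfl fun i hi => by
          rw [if_neg]; rintro rfl; exact (mem_sdiff.1 hi).2 hjT
      · rw [if_neg hjT]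
        have : ∏ i ∈ univ \ T, (if i = j then 0 else M - β i) = 0 :=
          prod_eq_zero (mem_sdiff.2 ⟨mem_univ j, hjT⟩) (if_pos rfl)
        rw [this, mul_zero]
    calc ∑ T ∈ (univ : Finset ι).powerset,
          (T.card : ℝ) / v * ((∏ j ∈ T, β j) * ∏ j ∈ univ \ T, (M - β j))
        = (1 / v) * ∑ T ∈ (univ : Finset ι).powerset,
            (T.card : ℝ) * ((∏ j ∈ T, β j) * ∏ j ∈ univ \ T, (M - β j)) := by
          rw [mul_sum]; refine sum_congr rfl fun T _ => ?_; ring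
      _ = (1 / v) * ∑ T ∈ (univ : Finset ι).powerset, ∑ j : ι,
            (if j ∈ T then (∏ i ∈ T, β i) * ∏ i ∈ univ \ T, (M - β i) else 0) := by
          congr 1
          refine sum_congr rfl fun T _ => ?_
          rw [← sum_filter, sum_const, nsmul_eq_mul]
          congr 2
          simp
      _ = (1 / v) * ∑ j, β j * M ^ (Fintype.card ι - 1) := by
          rw [sum_comm]; exact congr_arg _ (sum_congr rfl fun j _ => hlin j)
  -- assemble
  calc ∑ a : ι → γ, (if E a then ∏ j, w j (a j) else 0)
      = ∑ a : ι → γ, ∑ T ∈ (univ : Finset ι).powerset, (if E a then ∏ j, V T j (a j) else 0) := by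
        refine sum_congr rfl fun a _ => ?_
        split_ifs with h
        · exact hexpand a
        · simp
    _ = ∑ T ∈ (univ : Finset ι).powerset, ∑ a : ι → γ, (if E a then ∏ j, V T j (a j) else 0) :=
        sum_comm
    _ ≤ ∑ T ∈ (univ : Finset ι).powerset, (∑ a : ι → γ, (if E' a then ∏ j, V' T j (a j) else 0) +
          (if v < T.card then (∏ j ∈ T, β j) * ∏ j ∈ univ \ T, (M - β j) else 0)) :=
        sum_le_sum fun T _ => hT T
    _ = ∑ a : ι → γ, (if E' a then ∏ j, w' j (a j) else 0) +
          ∑ T ∈ (univ : Finset ι).powerset,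
            (if v < T.card then (∏ j ∈ T, β j) * ∏ j ∈ univ \ T, (M - β j) else 0) := by
        rw [sum_add_distrib, sum_comm]
        congr 1
        refine sum_congr rfl fun a _ => ?_
        split_ifs with h
        · exact (hexpand' a).symm
        · simp
    _ ≤ ∑ a : ι → γ, (if E' a then ∏ j, w' j (a j) else 0) +
          (1 / v) * ∑ j, β j * M ^ (Fintype.card ι - 1) := by linarith [hrare]
    _ = ∑ a : ι → γ, (if E' a then ∏ j, w' j (a j) else 0) +
          M ^ (Fintype.card ι - 1) / (2 * v) * ∑ j, ∑ o, |w j o - w' j o| := by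
        congr 1
        rw [sum_congr rfl fun j _ => hβ_abs j, mul_sum, mul_sum]
        refine sum_congr rfl fun j _ => ?_
        ring

end ProductWeights

end Literature.Computability.Complexity

end
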